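import Summits.KontsevichZagierPeriods.KontsevichZagierPeriods.Theorems.LinRedNormalFormArrangementNormalFormStubRebaseSimpleZeroNestedFinal

/-!
# Stub `stub_rebaseSimpleZeroTwo`, assembly (crux `ArrangementNormalForm`, line `janus-bands`) — brick `TwoPatterns`

Normalisation of the LINKING PATTERNS of two fibres `t₀, t₁` over a one-dimensional base `y`
(literal class `GS 0 2`, simple base pole `n₁ = 0`, `n₂ = 1`), for an ARBITRARY target set
`S ⊇ GG 0 2 2` and WITHOUT any hypothesis on the letters, relative to the single CLEAN-NEST
hypothesis `hC`: every clean nest `A(y) < tᵢ < tⱼ < B(y)` (any rows, any letters, literal `GS 0 2`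
integrand with exponents `0`, `1`) is congruent modulo `KZ.relations` to the subgroup generated
by `S`.
* `RebaseNest.good_halfA_of_clean` — the half-linked pattern `A < tᵢ < tⱼ`, `A' < tⱼ < B`: cut the
  base by the sign of `A − A'` (rule 1a); on `A' < A` the domain is the clean nest
  `A < tᵢ < tⱼ < B`; on `A < A'` one cut of the fibre `i` at the level `A'` gives the product
  `{A < tᵢ < A'} × {A' < tⱼ < B}` (product case `RebaseZero.good_literal`) and the clean nest
  `A' < tᵢ < tⱼ < B` (same moves as `RebaseNest.good_halfA`, which is the common-slope case);
* `RebaseNest.good_halfB_of_clean` — the mirror pattern, by the reflection `t ↦ −t` of both fibres;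
* `RebaseNest.good_nested_of_clean` — nested pairs: empty patterns / half-linked / clean;
* `RebaseNest.good_two_of_clean` — every literal `GS 0 2` datum: product fibres
  (`RebaseZero.good_literal`), a self-linked fibre (empty domain), or a nested pair.
Registered: `rebaseSimpleZeroTwo_of_clean` (literal binders).

References: M. Kontsevich, D. Zagier, *Periods* (2001), §1.2, rules (1a), (2).
-/

noncomputable section

open Set MeasureTheory MvPolynomial
open Literature.NumberTheory.Transcendental Literature.ModelTheory.ExponentialFields

namespace Summit.KontsevichZagierPeriods.ArrangementNormalForm.JanusBands

namespace RebaseNest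

open SeparatePos RebasePos RebaseZero

variable {S : Set KZ.FormalRep} {m m' : ℕ} {i j : Fin 2}

/-- Elements good for `GG 0 2 2` are good for any `S ⊇ GG 0 2 2`. [folklore] -/
theorem goodS_of_good (hS : GGset 0 2 2 ⊆ S) {x : KZ.FormalRep} (h : Good 2 x) :
    ∃ c ∈ AddSubgroup.closure S, x - c ∈ KZ.relations := by
  obtain ⟨c, hc, hx⟩ := h
  exact ⟨c, AddSubgroup.closure_mono hS hc, hx⟩

/-- **The half-linked pattern `A < tᵢ < tⱼ`, `A' < tⱼ < B`** (arbitrary letters) is good for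
`S ⊇ GG 0 2 2` given the clean-nest hypothesis: cut the base by the sign of `A − A'`; on `A' < A`
the domain is the clean nest `A < tᵢ < tⱼ < B`; on `A < A'` cut the fibre `i` at `A'` into the
product `{A < tᵢ < A'} × {A' < tⱼ < B}` and the clean nest `A' < tᵢ < tⱼ < B`.
[Kontsevich–Zagier 2001, §1.2, rules (1), (2)] -/
theorem good_halfA_of_clean (hS : GGset 0 2 2 ⊆ S)
    (hC : ∀ (m m₁ : ℕ) (r : KZ.IntegralRep (0 + 1 + 2)) (M₁ : Fin m₁ → Cf) (L : Fin m → (Fin 0 → ℚ) × ℚ)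
      (e : Fin m → ℕ) (p : MvPolynomial (Fin 0) ℚ) (ℓ₁ ℓ₂ : (Fin 0 → ℚ) × ℚ) (a : Fin 2 → Option Cf) (i j : Fin 2)
      (A Bd : Cf), i ≠ j → Bornology.IsBounded r.domain → r.domain = gDom 0 2 m₁ M₁ (nlo i A) (nhi j Bd) →
      EqOn r.integrand (glit 0 2 p L e ℓ₁ ℓ₂ 0 1 a) r.domain → ∃ c ∈ AddSubgroup.closure S, KZ.of r - c ∈ KZ.relations)
    (s : KZ.IntegralRep (0 + 1 + 2))
    (M : Fin m' → Cf) (L : Fin m → (Fin 0 → ℚ) × ℚ) (e : Fin m → ℕ) (p : MvPolynomial (Fin 0) ℚ)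
    (ℓ₁ ℓ₂ : (Fin 0 → ℚ) × ℚ) (a : Fin 2 → Option Cf) (lo hi : Fin 2 → Fin 2 ⊕ Cf) (hij : i ≠ j)
    (A A' B : Cf) (hbd : Bornology.IsBounded s.domain) (hdom : s.domain = gDom 0 2 m' M lo hi)
    (hint : EqOn s.integrand (glit 0 2 p L e ℓ₁ ℓ₂ 0 1 a) s.domain)
    (hloi : lo i = Sum.inr A) (hhii : hi i = Sum.inl j) (hloj : lo j = Sum.inr A') (hhij : hi j = Sum.inr B) :
    ∃ c ∈ AddSubgroup.closure S, KZ.of s - c ∈ KZ.relations := by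
  -- membership in the half-nested domain over any rows
  have memS : ∀ {m₁ : ℕ} (M₁ : Fin m₁ → Cf) (z : Fin (0 + 1 + 2) → ℝ), z ∈ gDom 0 2 m₁ M₁ lo hi ↔
      yv z ∈ cell M₁ ∧ (ev A (yv z) < tv z i ∧ tv z i < tv z j) ∧
        (ev A' (yv z) < tv z j ∧ tv z j < ev B (yv z)) := by
    intro m₁ M₁ z
    rw [mem_gDom_pair hij, hloi, hhii, hloj, hhij, rows_iff]
    simp only [RebaseNest.pv_inr, RebaseNest.pv_inl, affF_eq]
    rfl
  -- clean nests `A₁ < tᵢ < tⱼ < B` are good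
  have clean : ∀ {m₁ : ℕ} (M₁ : Fin m₁ → Cf) (r : KZ.IntegralRep (0 + 1 + 2)) (A₁ : Cf),
      Bornology.IsBounded r.domain → EqOn r.integrand (glit 0 2 p L e ℓ₁ ℓ₂ 0 1 a) r.domain →
      r.domain = gDom 0 2 m₁ M₁ (nlo i A₁) (nhi j B) →
      ∃ c ∈ AddSubgroup.closure S, KZ.of r - c ∈ KZ.relations := fun M₁ r A₁ hb hi' hd =>
    hC m _ r M₁ L e p ℓ₁ ℓ₂ a i j A₁ B hij hb hd hi'
  by_cases hAA : A = A'
  · subst hAA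
    refine clean M s A hbd hint ?_
    rw [hdom]
    ext z
    rw [memS, mem_nDom hij]
    constructor
    · rintro ⟨hy, ⟨h1', h2⟩, -, h4⟩; exact ⟨hy, h1', h2, h4⟩
    · rintro ⟨hy, h1', h2, h4⟩; exact ⟨hy, ⟨h1', h2⟩, h1'.trans h2, h4⟩
  -- cut the base at `A - A'`
  obtain ⟨s₁, s₂, hm₁, hm₂, hi₁, hi₂, hd₁, hd₂, hrel⟩ := cutBase s M lo hi hdom (A - A') (sub_ne_zero.2 hAA)
  have hs₁ : s₁.domain ⊆ s.domain := fun z hz => ((hm₁ z).1 hz).1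
  have hs₂ : s₂.domain ⊆ s.domain := fun z hz => ((hm₂ z).1 hz).1
  have hint₁ : EqOn s₁.integrand (glit 0 2 p L e ℓ₁ ℓ₂ 0 1 a) s₁.domain := fun z hz => by
    rw [hi₁]; exact hint (hs₁ hz)
  have hint₂ : EqOn s₂.integrand (glit 0 2 p L e ℓ₁ ℓ₂ 0 1 a) s₂.domain := fun z hz => by
    rw [hi₂]; exact hint (hs₂ hz)
  refine good_of_split hrel ?_ ?_
  · -- `A' < A`: the clean nest `A < tᵢ < tⱼ < B`
    refine clean (Fin.snoc M (A - A') : Fin (m' + 1) → Cf) s₁ A (hbd.subset hs₁) hint₁ ?_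
    rw [hd₁]
    ext z
    rw [memS, mem_nDom hij, mem_cell_snoc, ev_sub, sub_pos]
    constructor
    · rintro ⟨⟨hy, hr⟩, ⟨h1', h2⟩, -, h4⟩; exact ⟨⟨hy, hr⟩, h1', h2, h4⟩
    · rintro ⟨⟨hy, hr⟩, h1', h2, h4⟩; exact ⟨⟨hy, hr⟩, ⟨h1', h2⟩, (hr.trans h1').trans h2, h4⟩
  · -- `A < A'`: cut the fibre `i` at `A'`
    have memP : ∀ z, z ∈ gDom 0 2 (m' + 1) (Fin.snoc M (-(A - A')) : Fin (m' + 1) → Cf) lo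
        (Function.update hi i (Sum.inr A')) ↔ (yv z ∈ cell M ∧ ev A (yv z) < ev A' (yv z)) ∧
        (ev A (yv z) < tv z i ∧ tv z i < ev A' (yv z)) ∧ (ev A' (yv z) < tv z j ∧ tv z j < ev B (yv z)) := by
      intro z
      rw [mem_gDom_pair hij, hloi, Function.update_self, hloj, Function.update_of_ne hij.symm, hhij, rows_iff,
        mem_cell_snoc, ev_neg, ev_sub]
      simp only [RebaseNest.pv_inr, affF_eq, neg_sub, sub_pos]
      rfl
    have memN : ∀ z, z ∈ gDom 0 2 (m' + 1) (Fin.snoc M (-(A - A')) : Fin (m' + 1) → Cf)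
        (Function.update lo i (Sum.inr A')) hi ↔ (yv z ∈ cell M ∧ ev A (yv z) < ev A' (yv z)) ∧
        (ev A' (yv z) < tv z i ∧ tv z i < tv z j) ∧ (ev A' (yv z) < tv z j ∧ tv z j < ev B (yv z)) := by
      intro z
      rw [mem_gDom_pair hij, Function.update_self, hhii, Function.update_of_ne hij.symm, hloj, hhij, rows_iff,
        mem_cell_snoc, ev_neg, ev_sub]
      simp only [RebaseNest.pv_inr, RebaseNest.pv_inl, affF_eq, neg_sub, sub_pos]
      rfl
    obtain ⟨s₃, s₄, hd₃, hd₄, hi₃, hi₄, hs₃, hs₄, hrel'⟩ := cutFibre s₂ (Fin.snoc M (-(A - A')) : Fin (m' + 1) → Cf)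
      lo hi hd₂ i A' (fun z hz => by
        obtain ⟨-, -, h3, -⟩ := (memP z).1 hz
        rw [hhii, RebaseNest.pv_inl, affF_eq]
        exact h3.le)
      (fun z hz => by
        obtain ⟨⟨-, hr⟩, -, -⟩ := (memN z).1 hz
        rw [hloi, RebaseNest.pv_inr, affF_eq, affF_eq]
        exact hr.le)
    refine good_of_split hrel' ?_ ?_
    · -- the product `{A < tᵢ < A'} × {A' < tⱼ < B}`
      refine goodS_of_good hS (good_literal s₃ (Fin.snoc M (-(A - A')) : Fin (m' + 1) → Cf) L e p ℓ₁ ℓ₂ a lo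
        (Function.update hi i (Sum.inr A')) (Or.inl rfl) (fun l => ?_) ((hbd.subset hs₂).subset hs₃) hd₃
        fun z hz => by rw [hi₃]; exact hint₂ (hs₃ hz))
      rcases (fin_two_eq_or hij l).imp Eq.symm Eq.symm with rfl | rfl
      · exact ⟨⟨A, hloi⟩, ⟨A', by simp⟩⟩
      · exact ⟨⟨A', hloj⟩, ⟨B, by rw [Function.update_of_ne hij.symm, hhij]⟩⟩
    · -- the clean nest `A' < tᵢ < tⱼ < B`
      refine clean (Fin.snoc M (-(A - A')) : Fin (m' + 1) → Cf) s₄ A' ((hbd.subset hs₂).subset hs₄)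
        (fun z hz => by rw [hi₄]; exact hint₂ (hs₄ hz)) ?_
      rw [hd₄]
      ext z
      rw [memN, mem_nDom hij, mem_cell_snoc, ev_neg, ev_sub, neg_sub, sub_pos]
      constructor
      · rintro ⟨hy, ⟨h1', h2⟩, -, h4⟩; exact ⟨hy, h1', h2, h4⟩
      · rintro ⟨hy, h1', h2, h4⟩; exact ⟨hy, ⟨h1', h2⟩, h1'.trans h2, h4⟩

/-- **The half-linked pattern `A < tᵢ < B'`, `tᵢ < tⱼ < B`** (arbitrary letters) is good for
`S ⊇ GG 0 2 2` given the clean-nest hypothesis: the reflection `t ↦ −t` of both fibres turns it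
into the pattern of `good_halfA_of_clean`. [Kontsevich–Zagier 2001, §1.2, rules (1), (2)] -/
theorem good_halfB_of_clean (hS : GGset 0 2 2 ⊆ S)
    (hC : ∀ (m m₁ : ℕ) (r : KZ.IntegralRep (0 + 1 + 2)) (M₁ : Fin m₁ → Cf) (L : Fin m → (Fin 0 → ℚ) × ℚ)
      (e : Fin m → ℕ) (p : MvPolynomial (Fin 0) ℚ) (ℓ₁ ℓ₂ : (Fin 0 → ℚ) × ℚ) (a : Fin 2 → Option Cf) (i j : Fin 2)
      (A Bd : Cf), i ≠ j → Bornology.IsBounded r.domain → r.domain = gDom 0 2 m₁ M₁ (nlo i A) (nhi j Bd) →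
      EqOn r.integrand (glit 0 2 p L e ℓ₁ ℓ₂ 0 1 a) r.domain → ∃ c ∈ AddSubgroup.closure S, KZ.of r - c ∈ KZ.relations)
    (s : KZ.IntegralRep (0 + 1 + 2))
    (M : Fin m' → Cf) (L : Fin m → (Fin 0 → ℚ) × ℚ) (e : Fin m → ℕ) (p : MvPolynomial (Fin 0) ℚ)
    (ℓ₁ ℓ₂ : (Fin 0 → ℚ) × ℚ) (a : Fin 2 → Option Cf) (lo hi : Fin 2 → Fin 2 ⊕ Cf) (hij : i ≠ j)
    (A B' B : Cf) (hbd : Bornology.IsBounded s.domain) (hdom : s.domain = gDom 0 2 m' M lo hi)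
    (hint : EqOn s.integrand (glit 0 2 p L e ℓ₁ ℓ₂ 0 1 a) s.domain)
    (hloi : lo i = Sum.inr A) (hhii : hi i = Sum.inr B') (hloj : lo j = Sum.inl i) (hhij : hi j = Sum.inr B) :
    ∃ c ∈ AddSubgroup.closure S, KZ.of s - c ∈ KZ.relations := by
  obtain ⟨s', -, hbd', hdom', hint', hrel⟩ := pull (fun _ : Fin 2 => (-1 : ℚ)) (fun _ => 0) (fun _ => 0)
    s M L e p ℓ₁ ℓ₂ 0 1 a lo hi hbd hdom hint (fun _ => by norm_num) (hlink_const (-1) 0 _ _)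
  have hneg : ¬ (0 : ℚ) < -1 := by norm_num
  refine good_of_sub_mem hrel (good_halfA_of_clean hS hC s' M L e _ ℓ₁ ℓ₂ _ _ _ hij.symm (-B) (-B') (-A)
    hbd' hdom' hint' ?_ ?_ ?_ ?_)
  · simp only [pullLo, hneg, if_false, hhij, Sum.map_inr, pullC_neg_one]
  · simp only [pullHi, hneg, if_false, hloj, Sum.map_inl, id]
  · simp only [pullLo, hneg, if_false, hhii, Sum.map_inr, pullC_neg_one]
  · simp only [pullHi, hneg, if_false, hloi, Sum.map_inr, pullC_neg_one]

/-- **Nested pairs** (some bound of one fibre is the other fibre; arbitrary letters) are good for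
`S ⊇ GG 0 2 2` given the clean-nest hypothesis: self-links and double links have an empty domain,
half-linked patterns are `good_halfA_of_clean` / `good_halfB_of_clean`, clean nests are the
hypothesis. [Kontsevich–Zagier 2001, §1.2, rules (1), (2)] -/
theorem good_nested_of_clean (hS : GGset 0 2 2 ⊆ S)
    (hC : ∀ (m m₁ : ℕ) (r : KZ.IntegralRep (0 + 1 + 2)) (M₁ : Fin m₁ → Cf) (L : Fin m → (Fin 0 → ℚ) × ℚ)
      (e : Fin m → ℕ) (p : MvPolynomial (Fin 0) ℚ) (ℓ₁ ℓ₂ : (Fin 0 → ℚ) × ℚ) (a : Fin 2 → Option Cf) (i j : Fin 2)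
      (A Bd : Cf), i ≠ j → Bornology.IsBounded r.domain → r.domain = gDom 0 2 m₁ M₁ (nlo i A) (nhi j Bd) →
      EqOn r.integrand (glit 0 2 p L e ℓ₁ ℓ₂ 0 1 a) r.domain → ∃ c ∈ AddSubgroup.closure S, KZ.of r - c ∈ KZ.relations)
    (s : KZ.IntegralRep (0 + 1 + 2))
    (M : Fin m' → Cf) (L : Fin m → (Fin 0 → ℚ) × ℚ) (e : Fin m → ℕ) (p : MvPolynomial (Fin 0) ℚ)
    (ℓ₁ ℓ₂ : (Fin 0 → ℚ) × ℚ) (a : Fin 2 → Option Cf) (lo hi : Fin 2 → Fin 2 ⊕ Cf)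
    (hbd : Bornology.IsBounded s.domain) (hdom : s.domain = gDom 0 2 m' M lo hi)
    (hint : EqOn s.integrand (glit 0 2 p L e ℓ₁ ℓ₂ 0 1 a) s.domain)
    (hnest : ∃ i j : Fin 2, i ≠ j ∧ (hi i = Sum.inl j ∨ lo j = Sum.inl i)) :
    ∃ c ∈ AddSubgroup.closure S, KZ.of s - c ∈ KZ.relations := by
  obtain ⟨i, j, hij, hlink⟩ := hnest
  have mem := fun z => mem_gDom_pair hij M lo hi z
  have empty : (∀ z, z ∈ gDom 0 2 m' M lo hi → False) →
      ∃ c ∈ AddSubgroup.closure S, KZ.of s - c ∈ KZ.relations := fun h =>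
    goodS_of_good hS (good_of_dom_empty s fun z hz => h z (hdom ▸ hz))
  rcases hli : lo i with l | A
  · -- `lo i` is a fibre: empty
    refine empty fun z hz => ?_
    obtain ⟨-, ⟨h1i, h2i⟩, ⟨h1j, -⟩⟩ := (mem z).1 hz
    rw [hli, RebaseNest.pv_inl] at h1i
    rcases (fin_two_eq_or hij l).imp Eq.symm Eq.symm with rfl | rfl
    · exact lt_irrefl _ h1i
    · rcases hlink with h | h
      · rw [h, RebaseNest.pv_inl] at h2i; exact lt_asymm h1i h2i
      · rw [h, RebaseNest.pv_inl] at h1j; exact lt_asymm h1i h1j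
  rcases hhj : hi j with l | B
  · -- `hi j` is a fibre: empty
    refine empty fun z hz => ?_
    obtain ⟨-, ⟨-, h2i⟩, ⟨h1j, h2j⟩⟩ := (mem z).1 hz
    rw [hhj, RebaseNest.pv_inl] at h2j
    rcases (fin_two_eq_or hij l).imp Eq.symm Eq.symm with rfl | rfl
    · rcases hlink with h | h
      · rw [h, RebaseNest.pv_inl] at h2i; exact lt_asymm h2j h2i
      · rw [h, RebaseNest.pv_inl] at h1j; exact lt_asymm h2j h1j
    · exact lt_irrefl _ h2j
  rcases hhi' : hi i with l | B'
  · rcases (fin_two_eq_or hij l).imp Eq.symm Eq.symm with rfl | rfl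
    · -- `hi i = tᵢ`: empty
      refine empty fun z hz => ?_
      obtain ⟨-, ⟨-, h2i⟩, -⟩ := (mem z).1 hz
      rw [hhi', RebaseNest.pv_inl] at h2i
      exact lt_irrefl _ h2i
    · rcases hlj : lo j with l' | A'
      · rcases (fin_two_eq_or hij l').imp Eq.symm Eq.symm with rfl | rfl
        · -- clean nest
          obtain ⟨hlo, hhi⟩ := eq_nlo_nhi hij hli hhi' hlj hhj
          subst hlo hhi
          exact hC m m' s M L e p ℓ₁ ℓ₂ a i j A B hij hbd hdom hint
        · -- `lo j = tⱼ`: empty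
          refine empty fun z hz => ?_
          obtain ⟨-, -, ⟨h1j, -⟩⟩ := (mem z).1 hz
          rw [hlj, RebaseNest.pv_inl] at h1j
          exact lt_irrefl _ h1j
      · -- half-linked: `A < tᵢ < tⱼ`, `A' < tⱼ < B`
        exact good_halfA_of_clean hS hC s M L e p ℓ₁ ℓ₂ a lo hi hij A A' B hbd hdom hint hli hhi' hlj hhj
  · rcases hlj : lo j with l' | A'
    · rcases (fin_two_eq_or hij l').imp Eq.symm Eq.symm with rfl | rfl
      · -- half-linked: `A < tᵢ < B'`, `tᵢ < tⱼ < B`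
        exact good_halfB_of_clean hS hC s M L e p ℓ₁ ℓ₂ a lo hi hij A B' B hbd hdom hint hli hhi' hlj hhj
      · -- `lo j = tⱼ`: empty
        refine empty fun z hz => ?_
        obtain ⟨-, -, ⟨h1j, -⟩⟩ := (mem z).1 hz
        rw [hlj, RebaseNest.pv_inl] at h1j
        exact lt_irrefl _ h1j
    · -- no link at all: excluded
      exfalso
      rcases hlink with h | h
      · rw [hhi'] at h; cases h
      · rw [hlj] at h; cases h

/-- **Every literal `GS 0 2` datum** (simple base pole, arbitrary letters) is good for
`S ⊇ GG 0 2 2` given the clean-nest hypothesis: product fibres (`RebaseZero.good_literal`), a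
self-linked fibre (empty domain), or a nested pair (`good_nested_of_clean`).
[Kontsevich–Zagier 2001, §1.2, rules (1), (2)] -/
theorem good_two_of_clean (hS : GGset 0 2 2 ⊆ S)
    (hC : ∀ (m m₁ : ℕ) (r : KZ.IntegralRep (0 + 1 + 2)) (M₁ : Fin m₁ → Cf) (L : Fin m → (Fin 0 → ℚ) × ℚ)
      (e : Fin m → ℕ) (p : MvPolynomial (Fin 0) ℚ) (ℓ₁ ℓ₂ : (Fin 0 → ℚ) × ℚ) (a : Fin 2 → Option Cf) (i j : Fin 2)
      (A Bd : Cf), i ≠ j → Bornology.IsBounded r.domain → r.domain = gDom 0 2 m₁ M₁ (nlo i A) (nhi j Bd) →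
      EqOn r.integrand (glit 0 2 p L e ℓ₁ ℓ₂ 0 1 a) r.domain → ∃ c ∈ AddSubgroup.closure S, KZ.of r - c ∈ KZ.relations)
    (s : KZ.IntegralRep (0 + 1 + 2))
    (M : Fin m' → Cf) (L : Fin m → (Fin 0 → ℚ) × ℚ) (e : Fin m → ℕ) (p : MvPolynomial (Fin 0) ℚ)
    (ℓ₁ ℓ₂ : (Fin 0 → ℚ) × ℚ) (a : Fin 2 → Option Cf) (lo hi : Fin 2 → Fin 2 ⊕ Cf)
    (hbd : Bornology.IsBounded s.domain) (hdom : s.domain = gDom 0 2 m' M lo hi)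
    (hint : EqOn s.integrand (glit 0 2 p L e ℓ₁ ℓ₂ 0 1 a) s.domain) :
    ∃ c ∈ AddSubgroup.closure S, KZ.of s - c ∈ KZ.relations := by
  by_cases hprod : ∀ l, (∃ c, lo l = Sum.inr c) ∧ (∃ c, hi l = Sum.inr c)
  · exact goodS_of_good hS (good_literal s M L e p ℓ₁ ℓ₂ a lo hi (Or.inl rfl) hprod hbd hdom hint)
  obtain ⟨l, hl⟩ := not_forall.1 hprod
  -- a self-linked fibre has an empty domain
  have self : (lo l = Sum.inl l ∨ hi l = Sum.inl l) →
      ∃ c ∈ AddSubgroup.closure S, KZ.of s - c ∈ KZ.relations := fun h =>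
    goodS_of_good hS (good_of_dom_empty s fun z hz => by
      rw [hdom] at hz
      obtain ⟨h1, h2⟩ := hz.2 l
      rcases h with h | h
      · rw [h] at h1; exact lt_irrefl _ h1
      · rw [h] at h2; exact lt_irrefl _ h2)
  rcases hlo : lo l with l' | c
  · by_cases hll : l' = l
    · subst hll; exact self (Or.inl hlo)
    · exact good_nested_of_clean hS hC s M L e p ℓ₁ ℓ₂ a lo hi hbd hdom hint ⟨l', l, hll, Or.inr hlo⟩
  rcases hhi : hi l with l' | c'
  · by_cases hll : l' = l
    · subst hll; exact self (Or.inr hhi)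
    · exact good_nested_of_clean hS hC s M L e p ℓ₁ ℓ₂ a lo hi hbd hdom hint
        ⟨l, l', fun h => hll h.symm, Or.inl hhi⟩
  · exact absurd ⟨⟨c, hlo⟩, ⟨c', hhi⟩⟩ hl

end RebaseNest

/-- Registered support goal of this file (assembly of `stub_rebaseSimpleZeroTwo`, line
`janus-bands`): **reduction of the two-fibre rebase to clean nests.** For any target set
`S ⊇ GG 0 2 2` (literal class `SeparatePos.GGset 0 2 2`) for which every clean nest
`A(y) < tᵢ < tⱼ < B(y)` with a literal `GS 0 2` integrand (simple base pole, arbitrary letters) is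
`S`-good (hypothesis `hC`), EVERY representation with a literal `GS 0 2` datum (bounded
domain, exponents `0`, `1`) is congruent modulo `KZ.relations` to a `ℤ`-combination of elements of
`S`: product fibres by `RebaseZero.good_literal`, self-linked fibres are empty, nested pairs by the
normalisation of the linking patterns (`RebaseNest.good_nested_of_clean`).
[Kontsevich–Zagier 2001, §1.2, rules (1a), (2)] -/
theorem rebaseSimpleZeroTwo_of_clean (S : Set KZ.FormalRep) (hS : SeparatePos.GGset 0 2 2 ⊆ S) (hC : ∀ (m m₁ : ℕ) (r : KZ.IntegralRep (0 + 1 + 2)) (M₁ : Fin m₁ → (Fin (0 + 1) → ℚ) × ℚ) (L : Fin m → (Fin 0 → ℚ) × ℚ) (e : Fin m → ℕ) (p : MvPolynomial (Fin 0) ℚ) (ℓ₁ ℓ₂ : (Fin 0 → ℚ) × ℚ) (a : Fin 2 → Option ((Fin (0 + 1) → ℚ) × ℚ)) (i j : Fin 2) (A Bd : (Fin (0 + 1) → ℚ) × ℚ), i ≠ j → Bornology.IsBounded r.domain → r.domain = SeparatePos.gDom 0 2 m₁ M₁ (RebaseNest.nlo i A) (RebaseNest.nhi j Bd) → EqOn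 r.integrand (RebasePos.glit 0 2 p L e ℓ₁ ℓ₂ 0 1 a) r.domain → ∃ c ∈ AddSubgroup.closure S, KZ.of r - c ∈ KZ.relations) (m m' : ℕ) (s : KZ.IntegralRep (0 + 1 + 2)) (M : Fin m' → (Fin (0 + 1) → ℚ) × ℚ) (L : Fin m → (Fin 0 → ℚ) × ℚ) (e : Fin m → ℕ) (p : MvPolynomial (Fin 0) ℚ) (ℓ₁ ℓ₂ : (Fin 0 → ℚ) × ℚ) (a : Fin 2 → Option ((Fin (0 + 1) → ℚ) × ℚ)) (lo hi : Fin 2 → Fin 2 ⊕ ((Fin (0 + 1) → ℚ) × ℚ)) (hbd : Bornology.IsBounded s.domain) (hdom : s.domain = SeparatePos.gDom 0 2 m' M lo hi) (hint : EqOn s.integrand (RebasePos.glit 0 2 p L e ℓ₁ ℓ₂ 0 1 a) s.domain) : ∃ c ∈ AddSubgroup.closure S, KZ.of s - c ∈ KZ.relations :=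
  RebaseNest.good_two_of_clean hS hC s M L e p ℓ₁ ℓ₂ a lo hi hbd hdom hint

end Summit.KontsevichZagierPeriods.ArrangementNormalForm.JanusBands
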